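import Literature.NumberTheory.EllipticCurves.LocalTatePairingRestriction
import Literature.NumberTheory.GaloisRepresentations.OuterGaloisConjugation
import Literature.AnabelianGeometry.AbsoluteAnabelian.AbsAnabProp121viiHolds
import HarnessLib

/-!
# The local Tate pairing with points is invariant under OUTER Galois conjugation: `⟨ĝ·x, g·P⟩_F = ⟨x, P⟩_F`

Topic `NumberTheory/EllipticCurves`; namespace `Literature.NumberTheory.EllipticCurves`. THEOREMS ONLY (no definition, no named
fact, no instance, no `sorry`). Companion of `LocalTatePairingRestriction` (the degree formula `⟨Res x₀, P₀⟩_F = [F:F₀]·⟨x₀,P₀⟩_{F₀}`).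

Setting: an elliptic curve `W/K₀` (characteristic `0`), a field `F ⊇ K₀`, an automorphism `g` of `F` over `K₀` together with a lift
`ĝ : F̄ ≃ₐ[K₀] F̄` (`ĝ ∘ (F → F̄) = (F → F̄) ∘ g`), the induced OUTER conjugation `α : Γ_F ≃ Γ_F`, `α σ = ĝ σ ĝ⁻¹`
(`α σ • ĝ x = ĝ (σ • x)`), and the element `τ ∈ Γ_{K₀}` comparing the chosen embedding `j_F : K̄₀ → F̄` with `ĝ ∘ j_F`
(`j_F(τ x) = ĝ(j_F x)`; such `α`, `τ` exist, §1). Then `res_{F/K₀}(σ) = τ · res_{F/K₀}(α⁻¹ σ) · τ⁻¹` (§1), so the tree's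
«pull back along `α⁻¹`, then apply `T(τ)`» is an endomorphism `Conj` of `H¹(Γ_F, T_pW|_{Γ_F})` (on crossed homomorphisms
`η ↦ (σ ↦ τ • η(α⁻¹ σ))`), and for a non-archimedean local field `F` and `g` preserving the valuation:

  ★★ `tatePairingPoint_outerConj`: `⟨Conj x, g·P⟩_F = ⟨x, P⟩_F`   (`x ∈ H¹(F, T_pW|_{Γ_F})`, `P ∈ E(F)`, `g·P = P.map g`).

Levelwise (`⟨x,P⟩ mod p^k = inv_F(pr_k x ∪_{e_k} κ_{p^k}(P))`): `pr_k` and the Kummer classes commute with `Conj` (§3–§4: the root `Q` of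
`P` gives the root `ĝ_* Q` of `g·P`), the level Weil cup product is natural for the compatible pair `(α⁻¹; T(τ), T(τ), ĝ|μ)` (§2), and
**the local invariant map is preserved by the transport along `(α, ĝ|μ_n)`** (§5) — the tree's PROVED [AbsAnab] Prop. 1.2.1 (vii)
`galoisMLF_iso_residueMap_holds` (uniqueness of the residue map, Serre XIII §3) applied to `K₁ = K₂ = F`, `α`, `ψ̄ = ĝ|_{F̄ˣ}`, which is
`α`-equivariant and preserves absolute units and uniformisers because `g` preserves the valuation of `F`.

Use (crux K★ `stmt-BirchSwinnertonDyer-22226`, G5 «one constant» of [REC-tower]@cells by Galois descent): Kato's formula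
`⟨[η], P⟩ = Tr_{F/ℚ_p}(c · exp*_d(η) · log_ω P)` over a Galois extension `F/F₀` is `Gal(F/F₀)`-equivariant, hence holds with the averaged
constant `[F:F₀]⁻¹ Tr_{F/F₀}(c) ∈ F₀`. This file is the pairing third of that equivariance. BSD / K★ are not proved by this file.

## References
* J.-P. Serre, *Local Fields* (1979), XI §2 Prop. 1, XIII §3 (the invariant map and its functoriality in isomorphisms of local fields). [SerreLocalFields1979]
* J. Neukirch, A. Schmidt, K. Wingberg, *Cohomology of Number Fields* (2008), I §5 (1.5.3) (compatible pairs, conjugation), (7.1.4), (7.2.6). [NeukirchSchmidtWingberg2008]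
* S. Mochizuki, *The absolute anabelian geometry of hyperbolic curves* (2004), Prop. 1.2.1 (vii). [MochizukiAbsAnab2004]
* J. H. Silverman, *AEC* (2009), III §8 (Galois equivariance of `e_m`), VIII §2 (Kummer pairing). [SilvermanAEC2009]
-/

noncomputable section

open scoped Classical

open CategoryTheory Function Field
open Literature.NumberTheory.GaloisRepresentations
open Literature.NumberTheory.GaloisRepresentations.DiscreteGaloisModule (mu MuCarrier)
open Literature.NumberTheory.PAdicHodge (restrictedTateRep restrictedTateRep_apply_apply)
open Literature.AnabelianGeometry.AbsoluteAnabelian (Prop121vii.invLevel Prop121vii.cohTransport Prop121vii.muCarrierMap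
  Prop121vii.IsAlphaEquivariant Prop121vii.isEquivariantOver_muCarrierMap Prop121vii.intertwiningOfEquivariant
  galoisMLF_iso_residueMap_holds Prop121vii.isInvariantMap_invLevel Prop121vii.PreservesAbsUnits Prop121vii.PreservesUniformizers)

namespace Literature.NumberTheory.EllipticCurves

open _root_.WeierstrassCurve

variable {K₀ : Type} [Field K₀] [CharZero K₀] (W : WeierstrassCurve K₀) [W.IsElliptic]
  (F : Type) [Field F] [Algebra K₀ F] (p : ℕ) [hp : Fact p.Prime]

omit [CharZero K₀] [W.IsElliptic] in
/-- `p^k ≠ 0` in `ℤ`. [folklore] -/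
private theorem pow_ne_zero_int_o (k : ℕ) : ((p ^ k : ℕ) : ℤ) ≠ 0 := by
  exact_mod_cast pow_ne_zero k hp.out.ne_zero


/-! ### §2 The level Weil cup products under outer conjugation -/

section Level

variable [CharZero F] (e : (k : ℕ) → geomTorsion W ((p ^ k : ℕ) : ℤ) → geomTorsion W ((p ^ k : ℕ) : ℤ) → AlgebraicClosure K₀)
  (hμ : ∀ k S T, e k S T ^ (p ^ k) = 1)
  (hadd₁ : ∀ k S₁ S₂ T, e k (S₁ + S₂) T = e k S₁ T * e k S₂ T)
  (hadd₂ : ∀ k S T₁ T₂, e k S (T₁ + T₂) = e k S T₁ * e k S T₂)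
  (hgal : ∀ k (σ : absoluteGaloisGroup K₀) (S T : geomTorsion W ((p ^ k : ℕ) : ℤ)), σ • e k S T = e k (σ • S) (σ • T))
  (ĝ : AlgebraicClosure F ≃ₐ[K₀] AlgebraicClosure F)
  {α : absoluteGaloisGroup F ≃ₜ* absoluteGaloisGroup F}
  (hα : ∀ (σ : absoluteGaloisGroup F) (x : AlgebraicClosure F), α σ • ĝ x = ĝ (σ • x))
  {τ : absoluteGaloisGroup K₀}
  (hτ : ∀ x : AlgebraicClosure K₀, absClosureEmbedding K₀ F (τ • x) = ĝ (absClosureEmbedding K₀ F x))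
  (hconj : ∀ σ : absoluteGaloisGroup F,
    absGaloisRestrict K₀ F σ =
      τ * ((absGaloisRestrict K₀ F).comp (α.symm : absoluteGaloisGroup F →ₜ* absoluteGaloisGroup F)) σ * τ⁻¹)

omit [CharZero K₀] [W.IsElliptic] [CharZero F] in
include hα in
/-- **`ĝ|_{F̄ˣ}` is `α`-equivariant**: `ĝ(σ • x) = α σ • ĝ x` on units (the hypothesis `IsAlphaEquivariant` of [AbsAnab] Prop. 1.2.1 (vii)).
[cite: MochizukiAbsAnab2004, Prop. 1.2.1 (vi)] -/
theorem isAlphaEquivariant_outer :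
    Prop121vii.IsAlphaEquivariant α (Units.mapEquiv (ĝ : AlgebraicClosure F ≃ₐ[K₀] AlgebraicClosure F).toRingEquiv.toMulEquiv) := by
  intro σ x
  refine Units.ext ?_
  rw [Units.coe_smul]
  change ĝ ((σ • x : (AlgebraicClosure F)ˣ) : AlgebraicClosure F) = α σ • ĝ (x : AlgebraicClosure F)
  rw [Units.coe_smul, hα]

omit [CharZero K₀] [W.IsElliptic] [CharZero F] in
/-- On underlying elements of `F̄`, the coefficient map `ĝ|μ_n` (the tree's `Prop121vii.muCarrierMap`) is `ĝ`. [cite: MochizukiAbsAnab2004, Prop. 1.2.1 (vi)] -/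
theorem coe_muVal_muCarrierMap_outer (n : ℕ) (v : MuCarrier F n) :
    ((muVal F n (Prop121vii.muCarrierMap
        (Units.mapEquiv (ĝ : AlgebraicClosure F ≃ₐ[K₀] AlgebraicClosure F).toRingEquiv.toMulEquiv).toMonoidHom n v) :
          (AlgebraicClosure F)ˣ) : AlgebraicClosure F) =
      ĝ ((muVal F n v : (AlgebraicClosure F)ˣ) : AlgebraicClosure F) := rfl

omit [CharZero K₀] [W.IsElliptic] [CharZero F] in
include hgal hτ in
/-- The coefficient identity behind the outer conjugation of the Weil cup product: `ĝ(j_F e_k(S, T)) = j_F(e_k(τS, τT))` in `μ_{p^k}(F̄)`.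
[cite: SilvermanAEC2009, III §8 (Galois equivariance of `e_m`)] -/
theorem muCarrierMap_muTransfer_weilPairingHom (k : ℕ) (S T : geomTorsion W ((p ^ k : ℕ) : ℤ)) :
    Prop121vii.muCarrierMap (Units.mapEquiv (ĝ : AlgebraicClosure F ≃ₐ[K₀] AlgebraicClosure F).toRingEquiv.toMulEquiv).toMonoidHom
        (p ^ k) (muTransfer K₀ F (p ^ k) (weilPairingHom W (p ^ k) (e k) (hμ k) (hadd₁ k) (hadd₂ k) S T)) =
      muTransfer K₀ F (p ^ k) (weilPairingHom W (p ^ k) (e k) (hμ k) (hadd₁ k) (hadd₂ k) (τ • S) (τ • T)) := by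
  apply muVal_injective F (p ^ k)
  refine Units.ext ?_
  rw [coe_muVal_muCarrierMap_outer, muVal_muTransfer, muVal_muTransfer, Units.coe_map, MonoidHom.coe_coe, Units.coe_map,
    MonoidHom.coe_coe, weilPairingHom_smul W p e hμ hadd₁ hadd₂ hgal, muVal_apply, Units.coe_smul, hτ]

omit [CharZero K₀] [W.IsElliptic] in
include hτ in
/-- ★ **The level-`p^k` Weil cup product under outer conjugation**: for `a, b ∈ H¹(F, E[p^k]|)`,
`(Conj a) ∪_F (Conj b) = T²_{(α, ĝ|μ)}(a ∪_F b)` in `H²(Γ_F, μ_{p^k}(F̄))`, where `Conj = H¹(α⁻¹; T(τ))` and `T²` is the tree's transport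
`Prop121vii.cohTransport` along `(α, ĝ|μ_{p^k})`. Naturality of the cup product for the compatible pair `(α⁻¹; T(τ), T(τ), ĝ|μ)`.
[cite: NeukirchSchmidtWingberg2008, I §5 (1.5.3)] -/
theorem cupProduct_weilContPairingTransfer_outerConj (k : ℕ)
    (a b : continuousCohomology 1 (torsionRestricted W F (p ^ k)).toTopRep) :
    (weilContPairingTransfer W F p e hμ hadd₁ hadd₂ hgal k).cupProduct
        (ContinuousCohomology.map (α.symm : absoluteGaloisGroup F →ₜ* absoluteGaloisGroup F)
          ((W.torsionGaloisModule ((p ^ k : ℕ) : ℤ)).restrictConjHom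
            ((absGaloisRestrict K₀ F).comp (α.symm : absoluteGaloisGroup F →ₜ* absoluteGaloisGroup F))
            (absGaloisRestrict K₀ F) τ hconj) 1 a)
        (ContinuousCohomology.map (α.symm : absoluteGaloisGroup F →ₜ* absoluteGaloisGroup F)
          ((W.torsionGaloisModule ((p ^ k : ℕ) : ℤ)).restrictConjHom
            ((absGaloisRestrict K₀ F).comp (α.symm : absoluteGaloisGroup F →ₜ* absoluteGaloisGroup F))
            (absGaloisRestrict K₀ F) τ hconj) 1 b) =
      Prop121vii.cohTransport α (mu F (p ^ k)) (mu F (p ^ k))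
        (Prop121vii.muCarrierMap (Units.mapEquiv (ĝ : AlgebraicClosure F ≃ₐ[K₀] AlgebraicClosure F).toRingEquiv.toMulEquiv).toMonoidHom
          (p ^ k)) (Prop121vii.isEquivariantOver_muCarrierMap (isAlphaEquivariant_outer F ĝ hα) (p ^ k)) 2
        ((weilContPairingTransfer W F p e hμ hadd₁ hadd₂ hgal k).cupProduct a b) := by
  obtain ⟨f, rfl⟩ := oneCocycleClass_surjective _ a
  obtain ⟨g, rfl⟩ := oneCocycleClass_surjective _ b
  -- the transport `T²` on explicit cocycles (as in `Prop121vii.cohTransportCup_holds`)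
  let θ : absoluteGaloisGroup F →ₜ* absoluteGaloisGroup F := α.symm
  let ψu := Units.mapEquiv (ĝ : AlgebraicClosure F ≃ₐ[K₀] AlgebraicClosure F).toRingEquiv.toMulEquiv
  have hμe := Prop121vii.isEquivariantOver_muCarrierMap (isAlphaEquivariant_outer F ĝ hα) (p ^ k)
  let IdX : TopRep.res (θ : absoluteGaloisGroup F →* absoluteGaloisGroup F) (mu F (p ^ k)).toTopRep ⟶
      DiscreteGaloisModule.toTopRep (ContinuousRep.restrict (mu F (p ^ k)) θ) :=
    TopRep.ofHom ⟨ContinuousLinearMap.id ℤ (MuCarrier F (p ^ k)), fun _ => rfl⟩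
  let Fμ : TopRep.res ((ContinuousMonoidHom.id (absoluteGaloisGroup F) :
        absoluteGaloisGroup F →ₜ* absoluteGaloisGroup F) : absoluteGaloisGroup F →* absoluteGaloisGroup F)
        (DiscreteGaloisModule.toTopRep (ContinuousRep.restrict (mu F (p ^ k)) θ)) ⟶ (mu F (p ^ k)).toTopRep :=
    TopRep.ofHom ⟨(Prop121vii.intertwiningOfEquivariant α (mu F (p ^ k)) (mu F (p ^ k)) (Prop121vii.muCarrierMap ψu.toMonoidHom (p ^ k))
        hμe).toContinuousLinearMap,
      (Prop121vii.intertwiningOfEquivariant α (mu F (p ^ k)) (mu F (p ^ k)) (Prop121vii.muCarrierMap ψu.toMonoidHom (p ^ k))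
        hμe).isIntertwining'⟩
  have hT2 : ∀ c : contTwoCocycles (mu F (p ^ k)).toTopRep,
      Prop121vii.cohTransport α (mu F (p ^ k)) (mu F (p ^ k)) (Prop121vii.muCarrierMap ψu.toMonoidHom (p ^ k)) hμe 2
          (twoCocycleClass _ c) =
        twoCocycleClass _ (contTwoCocycles.pullback (ContinuousMonoidHom.id _) Fμ (contTwoCocycles.pullback θ IdX c)) := fun c => by
    show (ContinuousCohomology.map (ContinuousMonoidHom.id _) Fμ 2) ((ContinuousCohomology.map θ IdX 2) (twoCocycleClass _ c)) = _
    rw [map_twoCocycleClass, map_twoCocycleClass]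
  rw [map_oneCocycleClass, map_oneCocycleClass, ContPairing.cupProduct_oneCocycleClass_eq_twoCocycleClass,
    ContPairing.cupProduct_oneCocycleClass_eq_twoCocycleClass, hT2]
  refine congrArg (twoCocycleClass _) (Subtype.ext (ContinuousMap.ext fun q => ?_))
  obtain ⟨σ, σ'⟩ := q
  rw [ContPairing.cupCocycle_apply, contTwoCocycles.pullback_apply, contTwoCocycles.pullback_apply, ContPairing.cupCocycle_apply,
    contOneCocycles.pullback_apply, contOneCocycles.pullback_apply, contOneCocycles.pullback_apply, _root_.map_mul, ← map_sub]
  change muTransfer K₀ F (p ^ k) (weilPairingHom W (p ^ k) (e k) (hμ k) (hadd₁ k) (hadd₂ k) (τ • f.1 _) (τ • (g.1 _ - g.1 _))) =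
    Prop121vii.muCarrierMap ψu.toMonoidHom (p ^ k)
      (muTransfer K₀ F (p ^ k) (weilPairingHom W (p ^ k) (e k) (hμ k) (hadd₁ k) (hadd₂ k) (f.1 _) (g.1 _ - g.1 _)))
  rw [muCarrierMap_muTransfer_weilPairingHom W F p e hμ hadd₁ hadd₂ hgal ĝ hτ]
  rfl

/-! ### §3 The projections `pr_k` commute with outer conjugation -/

omit [CharZero K₀] [W.IsElliptic] [CharZero F] in
/-- **`pr_k ∘ Conj = Conj ∘ pr_k`** (`pr_k` commutes with `T(τ)` and with pull-back along `α⁻¹`). [cite: SilvermanAEC2009, III §7] -/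
theorem cohomologyMap_tateProjMor_outerConj (k : ℕ) (x : continuousCohomology 1 (restrictedTateRep W F p).toTopRep) :
    (cohomologyMap (tateProjMor W F p k) 1).hom
        (ContinuousCohomology.map (α.symm : absoluteGaloisGroup F →ₜ* absoluteGaloisGroup F)
          ((W.tateGaloisRep p (W.continuous_galoisRepTate_holds p)).toIntRep.restrictConjHom
            ((absGaloisRestrict K₀ F).comp (α.symm : absoluteGaloisGroup F →ₜ* absoluteGaloisGroup F))
            (absGaloisRestrict K₀ F) τ hconj) 1 x) =
      ContinuousCohomology.map (α.symm : absoluteGaloisGroup F →ₜ* absoluteGaloisGroup F)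
        ((W.torsionGaloisModule ((p ^ k : ℕ) : ℤ)).restrictConjHom
          ((absGaloisRestrict K₀ F).comp (α.symm : absoluteGaloisGroup F →ₜ* absoluteGaloisGroup F))
          (absGaloisRestrict K₀ F) τ hconj) 1 ((cohomologyMap (tateProjMor W F p k) 1).hom x) := by
  obtain ⟨η, rfl⟩ := oneCocycleClass_surjective _ x
  rw [map_oneCocycleClass, cohomologyMap_oneCocycleClass, cohomologyMap_oneCocycleClass, map_oneCocycleClass]
  refine congrArg (oneCocycleClass _) (Subtype.ext (ContinuousMap.ext fun σ => ?_))
  rw [pullback_id_resIdHom_apply, contOneCocycles.pullback_apply, contOneCocycles.pullback_apply, pullback_id_resIdHom_apply,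
    tateProjMor_hom_apply, tateProjMor_hom_apply]
  change tateProjHom W p k (τ • η.1 _) = W.torsionGaloisModule ((p ^ k : ℕ) : ℤ) τ (tateProjHom W p k (η.1 _))
  exact tateProjHom_smul W p k τ _

/-! ### §4 The Kummer classes under outer conjugation -/

omit [CharZero K₀] [W.IsElliptic] [CharZero F] in
include hτ in
/-- `j_F ∘ τ = ĝ ∘ j_F` on points: `pointsMap_F(τ • P) = ĝ_*(pointsMap_F P)` for `P ∈ E(K̄₀)`.
[cite: SilvermanAEC2009, VIII §1 (Galois action on points)] -/
theorem pointsMap_outer_smul (P : geomPoints W) :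
    pointsMap W F (τ • P) =
      WeierstrassCurve.Affine.Point.map (ĝ : AlgebraicClosure F →ₐ[K₀] AlgebraicClosure F) (show localPoints W F from pointsMap W F P) := by
  change WeierstrassCurve.Affine.Point.map _ (WeierstrassCurve.Affine.Point.map _ P) =
    WeierstrassCurve.Affine.Point.map _ (WeierstrassCurve.Affine.Point.map _ P)
  rw [WeierstrassCurve.Affine.Point.map_map, WeierstrassCurve.Affine.Point.map_map]
  refine congrArg (fun f => WeierstrassCurve.Affine.Point.map f P) (AlgHom.ext fun x => ?_)
  exact hτ x

omit [CharZero K₀] [W.IsElliptic] [CharZero F] in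
include hα in
/-- `ĝ_*` intertwines `α⁻¹`: `ĝ_*((α⁻¹ σ) • Q) = σ • ĝ_* Q` on `E(F̄)`. [cite: SilvermanAEC2009, VIII §1 (Galois action on points)] -/
theorem localPointsMap_outer_smul (σ : absoluteGaloisGroup F) (Q : localPoints W F) :
    WeierstrassCurve.Affine.Point.map (ĝ : AlgebraicClosure F →ₐ[K₀] AlgebraicClosure F)
        (show (W.baseChange (AlgebraicClosure F)).toAffine.Point from α.symm σ • Q) =
      (σ • (show localPoints W F from WeierstrassCurve.Affine.Point.map (ĝ : AlgebraicClosure F →ₐ[K₀] AlgebraicClosure F)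
        (show (W.baseChange (AlgebraicClosure F)).toAffine.Point from Q)) : localPoints W F) := by
  rw [localPoints.smul_def, localPoints.smul_def]
  change WeierstrassCurve.Affine.Point.map _ (WeierstrassCurve.Affine.Point.map _ Q) =
    WeierstrassCurve.Affine.Point.map _ (WeierstrassCurve.Affine.Point.map _ Q)
  rw [WeierstrassCurve.Affine.Point.map_map, WeierstrassCurve.Affine.Point.map_map]
  refine congrArg (fun f => WeierstrassCurve.Affine.Point.map f Q) (AlgHom.ext fun x => ?_)
  exact outerConj_symm_smul F ĝ hα σ x

omit [CharZero F] in
include hα hτ in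
/-- ★ **The Kummer classes under outer conjugation**: `Conj κ_{p^k}(P) = κ_{p^k}(P')` whenever `P' ∈ E(F)` is `ĝ_*` of `P` in `E(F̄)`
(hypothesis `hP`; e.g. `P' = P.map g`). The root `Q` of `P` gives the root `ĝ_* Q` of `P'`, and `τ • (Q^{α⁻¹σ} − Q) ↦ (ĝ_*Q)^σ − ĝ_*Q`.
[cite: SilvermanAEC2009, VIII §2] -/
theorem outerConj_kummerLevelClass (k : ℕ) (P P' : (W.baseChange F).toAffine.Point)
    (hP : (show (W.baseChange (AlgebraicClosure F)).toAffine.Point from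
        W.baseChangeGeomPointsEquiv F (toGeomPoints (W.baseChange F) P')) =
      WeierstrassCurve.Affine.Point.map (ĝ : AlgebraicClosure F →ₐ[K₀] AlgebraicClosure F)
        (show (W.baseChange (AlgebraicClosure F)).toAffine.Point from
          W.baseChangeGeomPointsEquiv F (toGeomPoints (W.baseChange F) P))) :
    ContinuousCohomology.map (α.symm : absoluteGaloisGroup F →ₜ* absoluteGaloisGroup F)
        ((W.torsionGaloisModule ((p ^ k : ℕ) : ℤ)).restrictConjHom
          ((absGaloisRestrict K₀ F).comp (α.symm : absoluteGaloisGroup F →ₜ* absoluteGaloisGroup F))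
          (absGaloisRestrict K₀ F) τ hconj) 1 (kummerLevelClass W F p k P) =
      kummerLevelClass W F p k P' := by
  -- the roots: `Q` of `P`, `ĝ_* Q` of `P'`
  set Q : localPoints W F := W.localZSMulRoot F (pow_ne_zero_int_o p k) P with hQdef
  have hQ : ((p ^ k : ℕ) : ℤ) • Q = W.baseChangeGeomPointsEquiv F (toGeomPoints (W.baseChange F) P) :=
    W.zsmul_localZSMulRoot F (pow_ne_zero_int_o p k) P
  set gpt : localPoints W F →+ localPoints W F :=
    (WeierstrassCurve.Affine.Point.map (ĝ : AlgebraicClosure F →ₐ[K₀] AlgebraicClosure F) :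
      (W.baseChange (AlgebraicClosure F)).toAffine.Point →+ (W.baseChange (AlgebraicClosure F)).toAffine.Point) with hgpt
  have hQ' : ((p ^ k : ℕ) : ℤ) • gpt Q = W.baseChangeGeomPointsEquiv F (toGeomPoints (W.baseChange F) P') := by
    rw [← map_zsmul, hQ]
    exact hP.symm
  rw [kummerLevelClass_eq_localKummerClass W F p k P Q hQ, kummerLevelClass_eq_localKummerClass W F p k P' (gpt Q) hQ',
    WeierstrassCurve.localKummerClass, WeierstrassCurve.localKummerClass, map_oneCocycleClass]
  refine congrArg (oneCocycleClass _) (Subtype.ext (ContinuousMap.ext fun σ => ?_))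
  rw [contOneCocycles.pullback_apply]
  apply Subtype.ext
  apply pointsMapOfEmb_injective W (closureEmb (K := K₀) F)
  change pointsMap W F (((W.torsionGaloisModule ((p ^ k : ℕ) : ℤ)) τ
      ((W.localKummerCocycle _ (pow_ne_zero_int_o p k) Q (W.zsmul_mem_fixedPoints_of_eq F hQ)).1 _) :
        geomTorsion W ((p ^ k : ℕ) : ℤ)) : geomPoints W) =
    pointsMap W F ((W.localKummerCocycle _ (pow_ne_zero_int_o p k) (gpt Q) (W.zsmul_mem_fixedPoints_of_eq F hQ')).1 σ :
      geomTorsion W ((p ^ k : ℕ) : ℤ))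
  rw [torsionGaloisModule_apply_apply, AddSubgroup.torsionBy.coe_smul, pointsMap_outer_smul W F ĝ hτ,
    WeierstrassCurve.pointsMap_localKummerCocycle_apply, WeierstrassCurve.pointsMap_localKummerCocycle_apply]
  change gpt (α.symm σ • Q - Q) = σ • gpt Q - gpt Q
  rw [map_sub, hgpt]
  exact congrArg (· - _) (localPointsMap_outer_smul W F ĝ hα σ Q)

omit [CharZero K₀] [W.IsElliptic] [CharZero F] in
/-- **Coordinates**: for `P ∈ E(F)` and `g·P := P.map g`, the point of `E(F̄)` underlying `g·P` is `ĝ_*` of the point underlying `P`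
(`ĝ ∘ (F → F̄) = (F → F̄) ∘ g` on coordinates) — the hypothesis `hP` of `outerConj_kummerLevelClass` / `tatePairingPoint_outerConj`.
[cite: SilvermanAEC2009, VIII §1 (points over field extensions)] -/
theorem baseChangeGeomPointsEquiv_toGeomPoints_map_outer (g : F ≃ₐ[K₀] F)
    (hĝ : ∀ c : F, ĝ (algebraMap F (AlgebraicClosure F) c) = algebraMap F (AlgebraicClosure F) (g c))
    (P : (W.baseChange F).toAffine.Point) :
    (show (W.baseChange (AlgebraicClosure F)).toAffine.Point from
        W.baseChangeGeomPointsEquiv F (toGeomPoints (W.baseChange F)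
          (WeierstrassCurve.Affine.Point.map (g : F →ₐ[K₀] F) P))) =
      WeierstrassCurve.Affine.Point.map (ĝ : AlgebraicClosure F →ₐ[K₀] AlgebraicClosure F)
        (show (W.baseChange (AlgebraicClosure F)).toAffine.Point from
          W.baseChangeGeomPointsEquiv F (toGeomPoints (W.baseChange F) P)) := by
  rcases P with _ | ⟨x, y, h⟩
  · rfl
  · change (WeierstrassCurve.Affine.Point.some _ _ _ : (W.baseChange (AlgebraicClosure F)).toAffine.Point) = .some _ _ _
    congr 1
    · exact (hĝ x).symm
    · exact (hĝ y).symm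

end Level

/-! ### §5 The invariant map is preserved by the transport along `(α, ĝ|μ_n)` -/

section Invariant

variable [ValuativeRel F] [TopologicalSpace F] [IsNonarchimedeanLocalField F] [CharZero F]
  (ĝ : AlgebraicClosure F ≃ₐ[K₀] AlgebraicClosure F) (g : F ≃ₐ[K₀] F)
  (hĝ : ∀ c : F, ĝ (algebraMap F (AlgebraicClosure F) c) = algebraMap F (AlgebraicClosure F) (g c))
  (hg : ∀ x : F, ValuativeRel.valuation F (g x) = ValuativeRel.valuation F x)
  {α : absoluteGaloisGroup F ≃ₜ* absoluteGaloisGroup F}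
  (hα : ∀ (σ : absoluteGaloisGroup F) (x : AlgebraicClosure F), α σ • ĝ x = ĝ (σ • x))

omit [CharZero K₀] [TopologicalSpace F] [IsNonarchimedeanLocalField F] [CharZero F] in
include hĝ hg in
/-- `ĝ` preserves integrality over `𝒪_F` (as `g` preserves `𝒪_F`). [cite: MochizukiAbsAnab2004, Prop. 1.2.1 (iii)] -/
theorem mem_absIntegers_outer {x : AlgebraicClosure F}
    (hx : x ∈ absIntegers (ValuativeRel.valuation F).integer F) :
    ĝ x ∈ absIntegers (ValuativeRel.valuation F).integer F := by
  have hO : ∀ c ∈ (ValuativeRel.valuation F).integer, (g : F →+* F) c ∈ (ValuativeRel.valuation F).integer := by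
    intro c hc
    rw [Valuation.mem_integer_iff] at hc ⊢
    change ValuativeRel.valuation F (g c) ≤ 1
    rwa [hg]
  let φ : (ValuativeRel.valuation F).integer →+* (ValuativeRel.valuation F).integer := (g : F →+* F).restrict _ _ hO
  have hcomp : (algebraMap (ValuativeRel.valuation F).integer (AlgebraicClosure F)).comp φ =
      (ĝ : AlgebraicClosure F →+* AlgebraicClosure F).comp (algebraMap (ValuativeRel.valuation F).integer (AlgebraicClosure F)) := by
    refine RingHom.ext fun c => ?_
    change algebraMap F (AlgebraicClosure F) (g c) = ĝ (algebraMap F (AlgebraicClosure F) c)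
    rw [hĝ]
  rw [mem_integralClosure_iff] at hx ⊢
  exact hx.map_of_comp_eq φ (ĝ : AlgebraicClosure F →+* AlgebraicClosure F) hcomp

omit [CharZero K₀] [TopologicalSpace F] [IsNonarchimedeanLocalField F] [CharZero F] in
include hĝ hg in
/-- **`ĝ|_{F̄ˣ}` preserves absolute units** (`𝒪_{F̄}ˣ`, the hypothesis `PreservesAbsUnits` of [AbsAnab] Prop. 1.2.1 (vii)): `g` preserves
`𝒪_F`, so `ĝ` and `ĝ⁻¹` preserve integrality over `𝒪_F`. [cite: MochizukiAbsAnab2004, Prop. 1.2.1 (iii)] -/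
theorem preservesAbsUnits_outer :
    Prop121vii.PreservesAbsUnits (Units.mapEquiv (ĝ : AlgebraicClosure F ≃ₐ[K₀] AlgebraicClosure F).toRingEquiv.toMulEquiv) := by
  have hĝs : ∀ c : F, ĝ.symm (algebraMap F (AlgebraicClosure F) c) = algebraMap F (AlgebraicClosure F) (g.symm c) := by
    intro c
    apply ĝ.injective
    rw [AlgEquiv.apply_symm_apply, hĝ, AlgEquiv.apply_symm_apply]
  have hgs : ∀ x : F, ValuativeRel.valuation F (g.symm x) = ValuativeRel.valuation F x := fun x => by
    conv_rhs => rw [← g.apply_symm_apply x, hg]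
  have key : ∀ y : AlgebraicClosure F,
      y ∈ absIntegers (ValuativeRel.valuation F).integer F ↔ ĝ y ∈ absIntegers (ValuativeRel.valuation F).integer F :=
    fun y => ⟨mem_absIntegers_outer F ĝ g hĝ hg, fun h => by
      simpa only [AlgEquiv.symm_apply_apply] using mem_absIntegers_outer F ĝ.symm g.symm hĝs hgs h⟩
  intro x
  change _ ↔ (ĝ (x : AlgebraicClosure F) ∈ _ ∧
    (((Units.mapEquiv (ĝ : AlgebraicClosure F ≃ₐ[K₀] AlgebraicClosure F).toRingEquiv.toMulEquiv x)⁻¹ : (AlgebraicClosure F)ˣ) :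
      AlgebraicClosure F) ∈ _)
  rw [← map_inv]
  change _ ↔ (ĝ (x : AlgebraicClosure F) ∈ _ ∧ ĝ ((x⁻¹ : (AlgebraicClosure F)ˣ) : AlgebraicClosure F) ∈ _)
  rw [← key, ← key]

omit [CharZero K₀] [CharZero F] in
include hĝ hg in
/-- **`ĝ|_{F̄ˣ}` carries uniformisers of `F` to uniformisers of `F`** (`g π` is a uniformiser when `π` is, `g` preserving the valuation;
the hypothesis `PreservesUniformizers` of [AbsAnab] Prop. 1.2.1 (vii)). [cite: MochizukiAbsAnab2004, Prop. 1.2.1 (iv)] -/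
theorem preservesUniformizers_outer :
    Prop121vii.PreservesUniformizers (Units.mapEquiv (ĝ : AlgebraicClosure F ≃ₐ[K₀] AlgebraicClosure F).toRingEquiv.toMulEquiv) := by
  intro π hπ
  refine ⟨Units.map (g : F →* F) π, ?_, Units.ext ?_⟩
  · change ValuativeRel.valuation F (g (π : F)) = _
    rw [hg]
    exact hπ
  · change ĝ (algebraMap F (AlgebraicClosure F) (π : F)) = algebraMap F (AlgebraicClosure F) (g (π : F))
    exact hĝ _

omit [CharZero K₀] in
include hĝ hg hα in
/-- ★ **The local invariant map is preserved by the transport along `(α, ĝ|μ_n)`**: `inv_{F,n}(T²_{(α, ĝ|μ_n)} z) = inv_{F,n}(z)` for every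
`z ∈ H²(Γ_F, μ_n(F̄))` — [AbsAnab] Prop. 1.2.1 (vii) (tree `galoisMLF_iso_residueMap_holds`: uniqueness of the residue map, Serre XIII §3) at
`K₁ = K₂ = F`, the outer conjugation `α` and `ψ̄ = ĝ|_{F̄ˣ}`. [cite: MochizukiAbsAnab2004, Prop. 1.2.1 (vii)] [cite: SerreLocalFields1979, XI §2 Prop. 1 and XIII §3] -/
theorem invLevel_cohTransport_outer (n : ℕ) [NeZero n] (z : galoisCohomology (mu F n) 2) :
    Prop121vii.invLevel F n (Prop121vii.cohTransport α (mu F n) (mu F n)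
        (Prop121vii.muCarrierMap (Units.mapEquiv (ĝ : AlgebraicClosure F ≃ₐ[K₀] AlgebraicClosure F).toRingEquiv.toMulEquiv).toMonoidHom n)
        (Prop121vii.isEquivariantOver_muCarrierMap (isAlphaEquivariant_outer F ĝ hα) n) 2 z) =
      Prop121vii.invLevel F n z := by
  have h := galoisMLF_iso_residueMap_holds F F α
    (Units.mapEquiv (ĝ : AlgebraicClosure F ≃ₐ[K₀] AlgebraicClosure F).toRingEquiv.toMulEquiv) n
    (isAlphaEquivariant_outer F ĝ hα) (preservesAbsUnits_outer F ĝ g hĝ hg) (preservesUniformizers_outer F ĝ g hĝ hg)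
    (Prop121vii.invLevel F n) (Prop121vii.invLevel F n) (Prop121vii.isInvariantMap_invLevel F n) (Prop121vii.isInvariantMap_invLevel F n)
  exact DFunLike.congr_fun h z

end Invariant

/-! ### §6 The pairing with points under outer conjugation -/

section Main

variable [ValuativeRel F] [TopologicalSpace F] [IsNonarchimedeanLocalField F] [CharZero F]
  (e : (k : ℕ) → geomTorsion W ((p ^ k : ℕ) : ℤ) → geomTorsion W ((p ^ k : ℕ) : ℤ) → AlgebraicClosure K₀)
  (hμ : ∀ k S T, e k S T ^ (p ^ k) = 1)
  (hadd₁ : ∀ k S₁ S₂ T, e k (S₁ + S₂) T = e k S₁ T * e k S₂ T)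
  (hadd₂ : ∀ k S T₁ T₂, e k S (T₁ + T₂) = e k S T₁ * e k S T₂)
  (hgal : ∀ k (σ : absoluteGaloisGroup K₀) (S T : geomTorsion W ((p ^ k : ℕ) : ℤ)), σ • e k S T = e k (σ • S) (σ • T))
  (hcompat : ∀ k (S T : geomTorsion W ((p ^ (k + 1) : ℕ) : ℤ)),
    e k (torsionMulHom W (p ^ (k + 1)) (p ^ k) p (pow_succ p k).symm S)
      (torsionMulHom W (p ^ (k + 1)) (p ^ k) p (pow_succ p k).symm T) = e (k + 1) S T ^ p)
  (ĝ : AlgebraicClosure F ≃ₐ[K₀] AlgebraicClosure F) (g : F ≃ₐ[K₀] F)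
  (hĝ : ∀ c : F, ĝ (algebraMap F (AlgebraicClosure F) c) = algebraMap F (AlgebraicClosure F) (g c))
  (hg : ∀ x : F, ValuativeRel.valuation F (g x) = ValuativeRel.valuation F x)
  {α : absoluteGaloisGroup F ≃ₜ* absoluteGaloisGroup F}
  (hα : ∀ (σ : absoluteGaloisGroup F) (x : AlgebraicClosure F), α σ • ĝ x = ĝ (σ • x))
  {τ : absoluteGaloisGroup K₀}
  (hτ : ∀ x : AlgebraicClosure K₀, absClosureEmbedding K₀ F (τ • x) = ĝ (absClosureEmbedding K₀ F x))
  (hconj : ∀ σ : absoluteGaloisGroup F,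
    absGaloisRestrict K₀ F σ =
      τ * ((absGaloisRestrict K₀ F).comp (α.symm : absoluteGaloisGroup F →ₜ* absoluteGaloisGroup F)) σ * τ⁻¹)

include hĝ hg hα hτ in
/-- ★★ **The local Tate pairing with points is invariant under outer Galois conjugation**: for a non-archimedean local field `F` of
characteristic `0`, `x ∈ H¹(F, T_pW|_{Γ_F})`, `P ∈ E(F)` and `P' = g·P` (hypothesis `hP`: `P'` is `ĝ_* P` in `E(F̄)`):
`⟨Conj x, P'⟩_F = ⟨x, P⟩_F` in `ℤ_p`, where `Conj = H¹(α⁻¹; T(τ))`. Levelwise `inv_F ∘ T²_{(α, ĝ|μ)} = inv_F` (§5, [AbsAnab] Prop. 1.2.1 (vii)) after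
§2–§4. [cite: SerreLocalFields1979, XI §2 Prop. 1 and XIII §3] [cite: NeukirchSchmidtWingberg2008, (7.1.4) and (7.2.6)] [cite: MochizukiAbsAnab2004, Prop. 1.2.1 (vii)] -/
theorem tatePairingPoint_outerConj (x : continuousCohomology 1 (restrictedTateRep W F p).toTopRep)
    (P P' : (W.baseChange F).toAffine.Point)
    (hP : (show (W.baseChange (AlgebraicClosure F)).toAffine.Point from
        W.baseChangeGeomPointsEquiv F (toGeomPoints (W.baseChange F) P')) =
      WeierstrassCurve.Affine.Point.map (ĝ : AlgebraicClosure F →ₐ[K₀] AlgebraicClosure F)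
        (show (W.baseChange (AlgebraicClosure F)).toAffine.Point from
          W.baseChangeGeomPointsEquiv F (toGeomPoints (W.baseChange F) P))) :
    tatePairingPoint W F p e hμ hadd₁ hadd₂ hgal hcompat
        (ContinuousCohomology.map (α.symm : absoluteGaloisGroup F →ₜ* absoluteGaloisGroup F)
          ((W.tateGaloisRep p (W.continuous_galoisRepTate_holds p)).toIntRep.restrictConjHom
            ((absGaloisRestrict K₀ F).comp (α.symm : absoluteGaloisGroup F →ₜ* absoluteGaloisGroup F))
            (absGaloisRestrict K₀ F) τ hconj) 1 x) P' =
      tatePairingPoint W F p e hμ hadd₁ hadd₂ hgal hcompat x P := by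
  refine PadicInt.ext_of_toZModPow.mp fun k => ?_
  rw [toZModPow_tatePairingPoint, toZModPow_tatePairingPoint, cohomologyMap_tateProjMor_outerConj W F p hconj,
    ← outerConj_kummerLevelClass W F p ĝ hα hτ hconj k P P' hP, levelTatePairing_eq_iota_weilCupProduct,
    levelTatePairing_eq_iota_weilCupProduct, cohomologyMap_muRestrictIso_cupProduct_restrict,
    cohomologyMap_muRestrictIso_cupProduct_restrict]
  have h := cupProduct_weilContPairingTransfer_outerConj W F p e hμ hadd₁ hadd₂ hgal ĝ hα hτ hconj k
    ((cohomologyMap (tateProjMor W F p k) 1).hom x) (kummerLevelClass W F p k P)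
  exact (congrArg (Prop121vii.invLevel F (p ^ k)) h).trans (invLevel_cohTransport_outer F ĝ g hĝ hg hα (p ^ k) _)

include hĝ hg hα hτ in
/-- ★★ The same at `P' = g·P := P.map g` (coordinates by `baseChangeGeomPointsEquiv_toGeomPoints_map_outer`):
`⟨Conj x, P.map g⟩_F = ⟨x, P⟩_F`. [cite: SerreLocalFields1979, XI §2 Prop. 1 and XIII §3] [cite: MochizukiAbsAnab2004, Prop. 1.2.1 (vii)] -/
theorem tatePairingPoint_outerConj_map (x : continuousCohomology 1 (restrictedTateRep W F p).toTopRep)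
    (P : (W.baseChange F).toAffine.Point) :
    tatePairingPoint W F p e hμ hadd₁ hadd₂ hgal hcompat
        (ContinuousCohomology.map (α.symm : absoluteGaloisGroup F →ₜ* absoluteGaloisGroup F)
          ((W.tateGaloisRep p (W.continuous_galoisRepTate_holds p)).toIntRep.restrictConjHom
            ((absGaloisRestrict K₀ F).comp (α.symm : absoluteGaloisGroup F →ₜ* absoluteGaloisGroup F))
            (absGaloisRestrict K₀ F) τ hconj) 1 x) (WeierstrassCurve.Affine.Point.map (g : F →ₐ[K₀] F) P) =
      tatePairingPoint W F p e hμ hadd₁ hadd₂ hgal hcompat x P :=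
  tatePairingPoint_outerConj W F p e hμ hadd₁ hadd₂ hgal hcompat ĝ g hĝ hg hα hτ hconj x P _
    (baseChangeGeomPointsEquiv_toGeomPoints_map_outer W F ĝ g hĝ P)

end Main

end Literature.NumberTheory.EllipticCurves

end
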